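import Literature.Analysis.FluidPDE.SteadyNSCaccioppoli
import Literature.Analysis.FluidPDE.SteadyLiouvilleCriteria
import Mathlib.Analysis.SpecialFunctions.Pow.Continuity
import Mathlib.Analysis.SpecialFunctions.Pow.Asymptotics
import HarnessLib

/-!
# Seregin–Wang 2020, Theorem 1.1 (i) holds: discharge of `SereginWang2020_annular_liouville`

Analysis/FluidPDE proof file (everything proved; sibling of `SteadyLiouvilleCriteriaProofs`, which
discharges Galdi's criterion of the same fact file). It discharges the named fact
`Literature.Analysis.FluidPDE.SereginWang2020_annular_liouville` (`SteadyLiouvilleCriteria.lean`;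
G. Seregin, W. Wang, St. Petersburg Math. J. 31 (2020) = arXiv:1805.02227, Thm 1.1 (i), Lebesgue
case `ℓ = q`, every `q > 3`, every viscosity `ν > 0`):

* `SereginWang2020_annular_liouville_holds : SereginWang2020_annular_liouville`.

The argument is that of §3 of the paper: the Caccioppoli inequality
(`SteadyCaccioppoli.caccioppoli`, file `SteadyNSCaccioppoli`) on the scale `R`, Hölder's
inequality on the annulus `B_R ∖ B_{R/2}` (`R⁻² ∫|u|² ≤ C R^{-1/3} M²(R)`, `R⁻¹ ∫|u|³ ≤ C M³(R)`,
`SereginWangProof.setIntegral_gradSq_le`), and the passage to the `lim inf` along `R → ∞`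
(`SereginWangProof.lintegral_le`); the "moreover" clause (`SereginWangProof.eq_zero_of_small`)
is the absorption `D ≤ c·lim inf M³ ≤ cδ D`, `D < ∞`, forcing `D = 0`, constancy of `U`, and the
divergence of `M(R) ∼ R^{2/3}` for a nonzero constant.

## References

* G. Seregin, W. Wang, St. Petersburg Math. J. 31 (2020) 387–393 = arXiv:1805.02227, Thm 1.1 (i)
  and §3. [SereginWang2020]
-/

noncomputable section

open MeasureTheory Set Filter Topology Function Metric intervalIntegral
open scoped RealInnerProductSpace ContDiff NNReal ENNReal

namespace Literature.Analysis.FluidPDE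

namespace SereginWangProof

open SteadyCaccioppoli CubeShell InnerProductSpace

/-- Local notation for physical space `ℝ³ = EuclideanSpace ℝ (Fin 3)`. -/
local notation "ℝ³" => EuclideanSpace ℝ (Fin 3)

/-! ### The annulus `B_R ∖ B_{R/2}` -/

section Annulus

/-- The annulus `A(R) = B_R ∖ B_{R/2}` of the statement (open balls). [folklore] -/
def ann (R : ℝ) : Set ℝ³ := ball (0 : ℝ³) R \ ball 0 (R / 2)

/-- Auxiliary (theorem `measurableSet_ann`): measurableSet ann. [folklore] -/
theorem measurableSet_ann (R : ℝ) : MeasurableSet (ann R) :=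
  measurableSet_ball.diff measurableSet_ball

/-- Auxiliary (theorem `ann_subset_ball`): ann subset ball. [folklore] -/
theorem ann_subset_ball (R : ℝ) : ann R ⊆ ball (0 : ℝ³) R := fun _ hx => hx.1

/-- Auxiliary (theorem `ann_subset_closedBall`): ann subset closedBall. [folklore] -/
theorem ann_subset_closedBall (R : ℝ) : ann R ⊆ closedBall (0 : ℝ³) R :=
  (ann_subset_ball R).trans ball_subset_closedBall

/-- Auxiliary (theorem `isBounded_ann`): isBounded ann. [folklore] -/
theorem isBounded_ann (R : ℝ) : Bornology.IsBounded (ann R) := isBounded_ball.subset (ann_subset_ball R)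

/-- `|A(R)| ≤ R³ |B₁|`. [folklore] -/
theorem volume_ann_le {R : ℝ} (hR : 0 ≤ R) : volume (ann R) ≤ ENNReal.ofReal (R ^ 3) * volume (ball (0 : ℝ³) 1) := by
  calc volume (ann R) ≤ volume (ball (0 : ℝ³) R) := measure_mono (ann_subset_ball R)
    _ = _ := by rw [Measure.addHaar_ball _ _ hR, finrank_euclideanSpace_fin]

/-- Auxiliary (theorem `volume_ann_lt_top`): volume ann lt top. [folklore] -/
theorem volume_ann_lt_top (R : ℝ) : volume (ann R) < ⊤ :=
  (measure_mono (ann_subset_ball R)).trans_lt measure_ball_lt_top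

/-- `|B₁| ∈ (0, ∞)` as a real number. [folklore] -/
def v₁ : ℝ := (volume (ball (0 : ℝ³) 1)).toReal

/-- Auxiliary (theorem `v₁_pos`): v₁ pos. [folklore] -/
theorem v₁_pos : 0 < v₁ := ENNReal.toReal_pos (measure_ball_pos volume 0 one_pos).ne' measure_ball_lt_top.ne

/-- Auxiliary (theorem `volume_real_ann_le`): volume real ann le. [folklore] -/
theorem volume_real_ann_le {R : ℝ} (hR : 0 ≤ R) : (volume (ann R)).toReal ≤ v₁ * R ^ 3 := by
  have h := volume_ann_le hR
  have hfin : ENNReal.ofReal (R ^ 3) * volume (ball (0 : ℝ³) 1) ≠ ⊤ :=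
    ENNReal.mul_ne_top ENNReal.ofReal_ne_top measure_ball_lt_top.ne
  calc (volume (ann R)).toReal ≤ (ENNReal.ofReal (R ^ 3) * volume (ball (0 : ℝ³) 1)).toReal :=
        ENNReal.toReal_mono hfin h
    _ = v₁ * R ^ 3 := by rw [ENNReal.toReal_mul, ENNReal.toReal_ofReal (by positivity), v₁]; ring

/-- The cube annulus of the Caccioppoli inequality lies in `A(R)`. [folklore] -/
theorem cubeAnnulus_subset_ann {R : ℝ} (hR : 0 < R) : cubeAnnulus R ⊆ ann R := cubeAnnulus_subset hR

/-- `B_{R/2} ⊆ cube (R/2)`. [folklore] -/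
theorem ball_subset_cube (R : ℝ) : ball (0 : ℝ³) (R / 2) ⊆ cube (R / 2) := fun x hx i =>
  (abs_coord_le_norm x i).trans (mem_ball_zero_iff.1 hx).le

end Annulus

/-! ### The annular `L^q` quantity as a real number -/

section Morrey

variable {q : ℝ} {U : ℝ³ → ℝ³}

/-- `J(R) = ∫_{A(R)} |U|^q` (real). [folklore] -/
def J (q : ℝ) (U : ℝ³ → ℝ³) (R : ℝ) : ℝ := ∫ x in ann R, ‖U x‖ ^ q

/-- Auxiliary (theorem `J_nonneg`): J nonneg. [folklore] -/
theorem J_nonneg (q : ℝ) (U : ℝ³ → ℝ³) (R : ℝ) : 0 ≤ J q U R :=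
  integral_nonneg fun _ => Real.rpow_nonneg (norm_nonneg _) _

/-- A continuous field is bounded on `A(R)`. [folklore] -/
theorem exists_bound_on_ann (hU : Continuous U) (R : ℝ) : ∃ C, 0 ≤ C ∧ ∀ x ∈ ann R, ‖U x‖ ≤ C := by
  obtain ⟨C, hC⟩ := (isCompact_closedBall (0 : ℝ³) R).exists_bound_of_continuousOn hU.continuousOn
  exact ⟨max C 0, le_max_right _ _, fun x hx => (hC x (ann_subset_closedBall R hx)).trans (le_max_left _ _)⟩

/-- Auxiliary (theorem `integrableOn_ann`): integrableOn ann. [folklore] -/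
theorem integrableOn_ann {g : ℝ³ → ℝ} (hg : Continuous g) (R : ℝ) : IntegrableOn g (ann R) volume :=
  (hg.continuousOn.integrableOn_compact (isCompact_closedBall (0 : ℝ³) R)).mono_set
    (ann_subset_closedBall R)

/-- Auxiliary (theorem `continuous_norm_rpow`): continuous norm rpow. [folklore] -/
theorem continuous_norm_rpow (hU : Continuous U) {p : ℝ} (hp : 0 ≤ p) : Continuous fun x => ‖U x‖ ^ p :=
  hU.norm.rpow_const fun _ => Or.inr hp


/-- **`M(R) = R^{2/3 − 3/q} J(R)^{1/q}`** (as an extended real): the annular quantity of the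
statement is finite for continuous `U`. [folklore] -/
theorem annularMorrey_eq (hU : Continuous U) (hq : 0 < q) {R : ℝ} (hR : 0 < R) :
    annularMorrey q U R = ENNReal.ofReal (R ^ (2 / 3 - 3 / q) * J q U R ^ (1 / q)) := by
  rw [annularMorrey]
  have hint : IntegrableOn (fun x => ‖U x‖ ^ q) (ann R) volume := integrableOn_ann (continuous_norm_rpow hU hq.le) R
  have h1 : ∫⁻ x in ball (0 : ℝ³) R \ ball 0 (R / 2), ‖U x‖ₑ ^ q = ENNReal.ofReal (J q U R) := by
    rw [J, show ball (0 : ℝ³) R \ ball 0 (R / 2) = ann R from rfl,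
      ofReal_integral_eq_lintegral_ofReal hint (Eventually.of_forall fun x => Real.rpow_nonneg (norm_nonneg _) _)]
    refine lintegral_congr fun x => ?_
    rw [← ofReal_norm, ENNReal.ofReal_rpow_of_nonneg (norm_nonneg _) hq.le]
  rw [h1, ENNReal.ofReal_rpow_of_nonneg (J_nonneg q U R) (by positivity),
    ← ENNReal.ofReal_mul (Real.rpow_nonneg hR.le _)]

/-- The real annular quantity `m(R) = R^{2/3 − 3/q} J(R)^{1/q}`. [folklore] -/
def m (q : ℝ) (U : ℝ³ → ℝ³) (R : ℝ) : ℝ := R ^ (2 / 3 - 3 / q) * J q U R ^ (1 / q)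

/-- Auxiliary (theorem `m_nonneg`): m nonneg. [folklore] -/
theorem m_nonneg {R : ℝ} (hR : 0 ≤ R) : 0 ≤ m q U R :=
  mul_nonneg (Real.rpow_nonneg hR _) (Real.rpow_nonneg (J_nonneg q U R) _)

/-- Auxiliary (theorem `annularMorrey_eq_ofReal_m`): annularMorrey eq ofReal m. [folklore] -/
theorem annularMorrey_eq_ofReal_m (hU : Continuous U) (hq : 0 < q) {R : ℝ} (hR : 0 < R) :
    annularMorrey q U R = ENNReal.ofReal (m q U R) := annularMorrey_eq hU hq hR

/-- `J^{1/q} = R^{3/q − 2/3} m`. [folklore] -/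
theorem J_rpow_eq {R : ℝ} (hR : 0 < R) :
    J q U R ^ (1 / q) = R ^ (3 / q - 2 / 3) * m q U R := by
  rw [m, ← mul_assoc, ← Real.rpow_add hR, show 3 / q - 2 / 3 + (2 / 3 - 3 / q) = 0 by ring,
    Real.rpow_zero, one_mul]

/-- **Hölder on the annulus**: `∫_{A(R)} |U|^s ≤ J^{s/q} |A(R)|^{1 − s/q}` for a natural `s < q`.
[folklore] -/
theorem setIntegral_norm_pow_le (hU : Continuous U) {s : ℕ} (hs0 : 0 < s) (hsq : (s : ℝ) < q) (R : ℝ) :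
    ∫ x in ann R, ‖U x‖ ^ s ≤ J q U R ^ ((s : ℝ) / q) * (volume (ann R)).toReal ^ (1 - (s : ℝ) / q) := by
  have hq : 0 < q := lt_trans (by exact_mod_cast hs0) hsq
  have ha0 : 0 < (s : ℝ) / q := by positivity
  have ha1 : (s : ℝ) / q < 1 := (div_lt_one hq).2 hsq
  have hpq := Real.HolderConjugate.inv_one_sub_inv ha0 ha1
  set μ := (volume : Measure ℝ³).restrict (ann R) with hμ
  haveI : IsFiniteMeasure μ := by rw [hμ]; exact isFiniteMeasure_restrict.2 (volume_ann_lt_top R).ne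
  obtain ⟨C, hC0, hC⟩ := exists_bound_on_ann hU R
  -- MemLp of `‖U‖^s` and of `1` for every exponent, on the finite measure
  have hmeas : AEStronglyMeasurable (fun x => ‖U x‖ ^ s) μ := (hU.norm.pow s).aestronglyMeasurable
  have hbd : ∀ᵐ x ∂μ, ‖(fun x => ‖U x‖ ^ s) x‖ ≤ C ^ s := by
    rw [hμ, ae_restrict_iff' (measurableSet_ann R)]
    refine Eventually.of_forall fun x hx => ?_
    rw [Real.norm_eq_abs, abs_pow, abs_norm]
    exact pow_le_pow_left₀ (norm_nonneg _) (hC x hx) s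
  have hf : MemLp (fun x => ‖U x‖ ^ s) (ENNReal.ofReal ((s : ℝ) / q)⁻¹) μ :=
    (memLp_top_of_bound hmeas (C ^ s) hbd).mono_exponent le_top
  have hg : MemLp (fun _ : ℝ³ => (1 : ℝ)) (ENNReal.ofReal (1 - (s : ℝ) / q)⁻¹) μ := memLp_const 1
  have h := integral_mul_le_Lp_mul_Lq_of_nonneg hpq (Eventually.of_forall fun x => by positivity)
    (Eventually.of_forall fun x => zero_le_one) hf hg
  simp only [mul_one, Real.one_rpow, MeasureTheory.integral_const, smul_eq_mul, one_div, inv_inv] at h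
  -- `(‖U‖^s)^{q/s} = ‖U‖^q`
  have hpow : ∫ x, (‖U x‖ ^ s) ^ ((s : ℝ) / q)⁻¹ ∂μ = J q U R := by
    rw [J, hμ]
    refine integral_congr_ae (Eventually.of_forall fun x => ?_)
    dsimp only
    rw [← Real.rpow_natCast, ← Real.rpow_mul (norm_nonneg _), inv_div,
      mul_div_cancel₀ _ (by exact_mod_cast hs0.ne')]
  rw [hpow, measureReal_def, hμ, Measure.restrict_apply_univ] at h
  exact h

/-- **The two annular norms in terms of `m`**: `∫_{A(R)}|U|² ≤ v₁^{1−2/q} m² R^{5/3}` and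
`∫_{A(R)}|U|³ ≤ v₁^{1−3/q} m³ R`. [folklore] -/
theorem setIntegral_norm_sq_le (hU : Continuous U) (hq : 3 < q) {R : ℝ} (hR : 0 < R) :
    ∫ x in ann R, ‖U x‖ ^ 2 ≤ v₁ ^ (1 - 2 / q) * m q U R ^ 2 * R ^ (5 / 3 : ℝ) := by
  have hq0 : 0 < q := by linarith
  have h := setIntegral_norm_pow_le (q := q) hU (s := 2) (by norm_num) (by push_cast; linarith) R
  push_cast at h
  have hm := m_nonneg (q := q) (U := U) hR.le
  have hV := volume_real_ann_le hR.le
  have hV0 : 0 ≤ (volume (ann R)).toReal := ENNReal.toReal_nonneg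
  have he : 0 ≤ 1 - 2 / q := by rw [sub_nonneg, div_le_one hq0]; linarith
  have h1 : J q U R ^ (2 / q) = (R ^ (3 / q - 2 / 3) * m q U R) ^ 2 := by
    rw [← J_rpow_eq hR, ← Real.rpow_natCast, ← Real.rpow_mul (J_nonneg q U R)]
    congr 1; push_cast; ring
  have h2 : (volume (ann R)).toReal ^ (1 - 2 / q) ≤ (v₁ * R ^ 3) ^ (1 - 2 / q) :=
    Real.rpow_le_rpow hV0 hV he
  calc ∫ x in ann R, ‖U x‖ ^ 2 ≤ J q U R ^ (2 / q) * (volume (ann R)).toReal ^ (1 - 2 / q) := h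
    _ ≤ (R ^ (3 / q - 2 / 3) * m q U R) ^ 2 * (v₁ * R ^ 3) ^ (1 - 2 / q) := by
        rw [h1]; exact mul_le_mul_of_nonneg_left h2 (sq_nonneg _)
    _ = v₁ ^ (1 - 2 / q) * m q U R ^ 2 * R ^ (5 / 3 : ℝ) := by
        rw [mul_pow, Real.mul_rpow v₁_pos.le (by positivity), ← Real.rpow_natCast (R ^ (3 / q - 2 / 3)) 2,
          ← Real.rpow_mul hR.le, ← Real.rpow_natCast R 3, ← Real.rpow_mul hR.le]
        have : R ^ ((3 / q - 2 / 3) * ((2 : ℕ) : ℝ)) * R ^ ((3 : ℕ) * (1 - 2 / q) : ℝ) = R ^ (5 / 3 : ℝ) := by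
          rw [← Real.rpow_add hR]; congr 1; push_cast; ring
        calc _ = v₁ ^ (1 - 2 / q) * m q U R ^ 2 * (R ^ ((3 / q - 2 / 3) * ((2 : ℕ) : ℝ)) *
            R ^ ((3 : ℕ) * (1 - 2 / q) : ℝ)) := by ring
          _ = _ := by rw [this]

/-- Auxiliary (theorem `setIntegral_norm_cube_le`): setIntegral norm cube le. [folklore] -/
theorem setIntegral_norm_cube_le (hU : Continuous U) (hq : 3 < q) {R : ℝ} (hR : 0 < R) :
    ∫ x in ann R, ‖U x‖ ^ 3 ≤ v₁ ^ (1 - 3 / q) * m q U R ^ 3 * R := by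
  have hq0 : 0 < q := by linarith
  have h := setIntegral_norm_pow_le (q := q) hU (s := 3) (by norm_num) (by push_cast; linarith) R
  push_cast at h
  have hm := m_nonneg (q := q) (U := U) hR.le
  have hV := volume_real_ann_le hR.le
  have hV0 : 0 ≤ (volume (ann R)).toReal := ENNReal.toReal_nonneg
  have he : 0 ≤ 1 - 3 / q := by rw [sub_nonneg, div_le_one hq0]; linarith
  have h1 : J q U R ^ (3 / q) = (R ^ (3 / q - 2 / 3) * m q U R) ^ 3 := by
    rw [← J_rpow_eq hR, ← Real.rpow_natCast, ← Real.rpow_mul (J_nonneg q U R)]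
    congr 1; push_cast; ring
  have h2 : (volume (ann R)).toReal ^ (1 - 3 / q) ≤ (v₁ * R ^ 3) ^ (1 - 3 / q) :=
    Real.rpow_le_rpow hV0 hV he
  calc ∫ x in ann R, ‖U x‖ ^ 3 ≤ J q U R ^ (3 / q) * (volume (ann R)).toReal ^ (1 - 3 / q) := h
    _ ≤ (R ^ (3 / q - 2 / 3) * m q U R) ^ 3 * (v₁ * R ^ 3) ^ (1 - 3 / q) := by
        rw [h1]; exact mul_le_mul_of_nonneg_left h2 (pow_nonneg (mul_nonneg (Real.rpow_nonneg hR.le _) hm) 3)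
    _ = v₁ ^ (1 - 3 / q) * m q U R ^ 3 * R := by
        rw [mul_pow, Real.mul_rpow v₁_pos.le (by positivity), ← Real.rpow_natCast (R ^ (3 / q - 2 / 3)) 3,
          ← Real.rpow_mul hR.le, ← Real.rpow_natCast R 3, ← Real.rpow_mul hR.le]
        have : R ^ ((3 / q - 2 / 3) * ((3 : ℕ) : ℝ)) * R ^ ((3 : ℕ) * (1 - 3 / q) : ℝ) = R := by
          rw [← Real.rpow_add hR]
          have e : (3 / q - 2 / 3) * ((3 : ℕ) : ℝ) + (3 : ℕ) * (1 - 3 / q) = 1 := by push_cast; ring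
          rw [e, Real.rpow_one]
        calc _ = v₁ ^ (1 - 3 / q) * m q U R ^ 3 * (R ^ ((3 / q - 2 / 3) * ((3 : ℕ) : ℝ)) *
            R ^ ((3 : ℕ) * (1 - 3 / q) : ℝ)) := by ring
          _ = _ := by rw [this]

end Morrey

/-! ### From the Caccioppoli inequality to `m(R)` -/

section Main

variable {ν q : ℝ} {U : ℝ³ → ℝ³} {P : ℝ³ → ℝ}

/-- The Caccioppoli constant. [folklore] -/
def Cc : ℝ := Classical.choose caccioppoli

/-- Auxiliary (theorem `Cc_pos`): Cc pos. [folklore] -/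
theorem Cc_pos : 0 < Cc := (Classical.choose_spec caccioppoli).1

/-- Auxiliary (theorem `Cc_spec`): Cc spec. [folklore] -/
theorem Cc_spec {ν R : ℝ} {U : ℝ³ → ℝ³} {P : ℝ³ → ℝ} (hν : 0 < ν) (hR : 0 < R)
    (hUP : IsLerayProfile ν 0 U P) (hU : ContDiff ℝ ∞ U) :
    ν * ∫ x in cube (R / 2), gradSq U x ≤
      Cc * (ν / R ^ 2 * (∫ x in cubeAnnulus R, ‖U x‖ ^ 2) + 1 / R * ∫ x in cubeAnnulus R, ‖U x‖ ^ 3) :=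
  (Classical.choose_spec caccioppoli).2 ν R U P hν hR hUP hU

/-- **The constant of Theorem 1.1 (i)** (Lebesgue instance `ℓ = q`, viscosity `ν`):
`c(q, ν) = C |B₁|^{1 − 3/q} / ν`. [folklore] -/
def cSW (ν q : ℝ) : ℝ := Cc * v₁ ^ (1 - 3 / q) / ν

/-- Auxiliary (theorem `cSW_pos`): cSW pos. [folklore] -/
theorem cSW_pos (hν : 0 < ν) : 0 < cSW ν q := by
  rw [cSW]; have := Cc_pos; have := v₁_pos; positivity

/-- The coefficient of the vanishing term. [folklore] -/
def k₁ (q : ℝ) : ℝ := Cc * v₁ ^ (1 - 2 / q)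

/-- Auxiliary (theorem `k₁_pos`): k₁ pos. [folklore] -/
theorem k₁_pos : 0 < k₁ q := by rw [k₁]; have := Cc_pos; have := v₁_pos; positivity

/-- **`∫_{cube R/2} |∇U|² ≤ k₁ R^{-1/3} m(R)² + c m(R)³`** (Seregin–Wang 2020, §3, proof of (i):
"`R⁻² ∫_{B_R∖B_{R/2}} |u|² ≤ C(q) R^{1 − 6/q} ‖u‖² ≤ C(q) R^{-1/3} M²(R)`" inserted in (2.1)).
[cite: SereginWang2020, §3 (proof of Thm 1.1 (i))] -/
theorem setIntegral_gradSq_le (hν : 0 < ν) (hq : 3 < q) (hUP : IsLerayProfile ν 0 U P)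
    (hU : ContDiff ℝ ∞ U) {R : ℝ} (hR : 0 < R) :
    ∫ x in cube (R / 2), gradSq U x ≤
      k₁ q * R ^ (-(1 / 3 : ℝ)) * m q U R ^ 2 + cSW ν q * m q U R ^ 3 := by
  have hUc : Continuous U := hU.continuous
  have hC := Cc_spec hν hR hUP hU
  have hsub := cubeAnnulus_subset_ann hR
  have N2 : ∫ x in cubeAnnulus R, ‖U x‖ ^ 2 ≤ ∫ x in ann R, ‖U x‖ ^ 2 :=
    setIntegral_mono_set (integrableOn_ann (hUc.norm.pow 2) R) (Eventually.of_forall fun x => by positivity)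
      hsub.eventuallyLE
  have N3 : ∫ x in cubeAnnulus R, ‖U x‖ ^ 3 ≤ ∫ x in ann R, ‖U x‖ ^ 3 :=
    setIntegral_mono_set (integrableOn_ann (hUc.norm.pow 3) R) (Eventually.of_forall fun x => by positivity)
      hsub.eventuallyLE
  have H2 := (N2.trans (setIntegral_norm_sq_le (U := U) hUc hq hR))
  have H3 := (N3.trans (setIntegral_norm_cube_le (U := U) hUc hq hR))
  have hm := m_nonneg (q := q) (U := U) hR.le
  have hCc := Cc_pos
  have hv := v₁_pos
  -- monotonicity of the right-hand side of Caccioppoli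
  have c1 : 0 ≤ Cc * (ν / R ^ 2) := by positivity
  have c2 : 0 ≤ Cc * (1 / R) := by positivity
  have hX : ν * ∫ x in cube (R / 2), gradSq U x ≤
      Cc * (ν / R ^ 2) * (v₁ ^ (1 - 2 / q) * m q U R ^ 2 * R ^ (5 / 3 : ℝ)) +
      Cc * (1 / R) * (v₁ ^ (1 - 3 / q) * m q U R ^ 3 * R) := by
    have := mul_le_mul_of_nonneg_left H2 c1
    have := mul_le_mul_of_nonneg_left H3 c2
    linarith
  -- the algebra `R^{5/3}/R² = R^{-1/3}`
  have e : Cc * (ν / R ^ 2) * (v₁ ^ (1 - 2 / q) * m q U R ^ 2 * R ^ (5 / 3 : ℝ)) +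
      Cc * (1 / R) * (v₁ ^ (1 - 3 / q) * m q U R ^ 3 * R) =
      ν * (k₁ q * R ^ (-(1 / 3 : ℝ)) * m q U R ^ 2 + cSW ν q * m q U R ^ 3) := by
    have h53 : R ^ (5 / 3 : ℝ) = R ^ (-(1 / 3 : ℝ)) * R ^ 2 := by
      rw [← Real.rpow_natCast R 2, ← Real.rpow_add hR]; norm_num
    rw [h53, k₁, cSW]
    field_simp
  rw [e] at hX
  exact le_of_mul_le_mul_left hX hν

/-- The Dirichlet energy density is the `gradSq` of the tree's cube estimate. [folklore] -/
theorem frobeniusNormSq_eq_gradSq (U : ℝ³ → ℝ³) (x : ℝ³) :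
    frobeniusNormSq (fderiv ℝ U x) = gradSq U x := (gradSq_eq_frobeniusNormSq U x).symm

/-- Auxiliary (theorem `continuous_frobeniusNormSq_fderiv`): continuous frobeniusNormSq fderiv. [folklore] -/
theorem continuous_frobeniusNormSq_fderiv (hU : ContDiff ℝ ∞ U) :
    Continuous fun x => frobeniusNormSq (fderiv ℝ U x) := by
  simp only [frobeniusNormSq_eq_gradSq]; exact continuous_gradSq (hU.of_le (by simp))

/-- **`∫⁻_{B_{R/2}} |∇U|² ≤ ofReal (k₁ R^{-1/3} m² + c m³)`.** [folklore] -/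
theorem lintegral_ball_le (hν : 0 < ν) (hq : 3 < q) (hUP : IsLerayProfile ν 0 U P)
    (hU : ContDiff ℝ ∞ U) {R : ℝ} (hR : 0 < R) :
    ∫⁻ x in ball (0 : ℝ³) (R / 2), ENNReal.ofReal (frobeniusNormSq (fderiv ℝ U x)) ≤
      ENNReal.ofReal (k₁ q * R ^ (-(1 / 3 : ℝ)) * m q U R ^ 2 + cSW ν q * m q U R ^ 3) := by
  have hc : Continuous (gradSq U) := continuous_gradSq (hU.of_le (by simp))
  have hint : IntegrableOn (gradSq U) (cube (R / 2)) volume :=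
    hc.continuousOn.integrableOn_compact (isCompact_cube _)
  calc ∫⁻ x in ball (0 : ℝ³) (R / 2), ENNReal.ofReal (frobeniusNormSq (fderiv ℝ U x))
      ≤ ∫⁻ x in cube (R / 2), ENNReal.ofReal (frobeniusNormSq (fderiv ℝ U x)) :=
        lintegral_mono_set (ball_subset_cube R)
    _ = ENNReal.ofReal (∫ x in cube (R / 2), gradSq U x) := by
        simp only [frobeniusNormSq_eq_gradSq]
        rw [ofReal_integral_eq_lintegral_ofReal hint (Eventually.of_forall fun x => gradSq_nonneg U x)]
    _ ≤ _ := ENNReal.ofReal_le_ofReal (setIntegral_gradSq_le hν hq hUP hU hR)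

/-! ### The `lim inf` argument -/

/-- Along the `lim inf`: for every `η > 0` and `R₀` there is `R ≥ R₀`, `R > 0`, with
`m(R) < ℓ + η`, `ℓ = (lim inf M).toReal`. [folklore] -/
theorem exists_m_lt (hU : Continuous U) (hq : 0 < q) (hL : liminf (annularMorrey q U) atTop < ⊤)
    {η : ℝ} (hη : 0 < η) (R₀ : ℝ) :
    ∃ R, R₀ ≤ R ∧ 0 < R ∧ m q U R < (liminf (annularMorrey q U) atTop).toReal + η := by
  set L := liminf (annularMorrey q U) atTop with hLdef
  have hLr : L = ENNReal.ofReal L.toReal := (ENNReal.ofReal_toReal hL.ne).symm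
  have hlt : L < ENNReal.ofReal (L.toReal + η) := by
    conv_lhs => rw [hLr]
    exact (ENNReal.ofReal_lt_ofReal_iff (by positivity)).2 (by linarith)
  have hfreq : ∃ᶠ R in atTop, annularMorrey q U R < ENNReal.ofReal (L.toReal + η) :=
    frequently_lt_of_liminf_lt (by isBoundedDefault) hlt
  rw [frequently_atTop] at hfreq
  obtain ⟨R, hR, hMR⟩ := hfreq (max R₀ 1)
  have hRpos : 0 < R := lt_of_lt_of_le one_pos ((le_max_right _ _).trans hR)
  refine ⟨R, (le_max_left _ _).trans hR, hRpos, ?_⟩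
  rw [annularMorrey_eq_ofReal_m hU hq hRpos] at hMR
  exact (ENNReal.ofReal_lt_ofReal_iff (by positivity)).1 hMR

/-- **`D(U) ≤ η + c (ℓ + η)³` for every `η > 0`.** [folklore] -/
theorem lintegral_le_eta (hν : 0 < ν) (hq : 3 < q) (hUP : IsLerayProfile ν 0 U P)
    (hU : ContDiff ℝ ∞ U) (hL : liminf (annularMorrey q U) atTop < ⊤) {η : ℝ} (hη : 0 < η) :
    ∫⁻ x, ENNReal.ofReal (frobeniusNormSq (fderiv ℝ U x)) ≤
      ENNReal.ofReal (η + cSW ν q * ((liminf (annularMorrey q U) atTop).toReal + η) ^ 3) := by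
  set ℓ := (liminf (annularMorrey q U) atTop).toReal with hℓ
  have hℓ0 : 0 ≤ ℓ := ENNReal.toReal_nonneg
  have hq0 : 0 < q := by linarith
  have hc := (cSW_pos (q := q) hν).le
  have hk := (k₁_pos (q := q)).le
  -- `R₁` beyond which the vanishing term is `≤ η`
  obtain ⟨R₁, hR₁⟩ : ∃ R₁ : ℝ, ∀ R, R₁ ≤ R → k₁ q * R ^ (-(1 / 3 : ℝ)) * (ℓ + η) ^ 2 ≤ η := by
    have ht : Tendsto (fun R : ℝ => k₁ q * R ^ (-(1 / 3 : ℝ)) * (ℓ + η) ^ 2) atTop (𝓝 (k₁ q * 0 * (ℓ + η) ^ 2)) :=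
      ((tendsto_rpow_neg_atTop (by norm_num : (0 : ℝ) < 1 / 3)).const_mul _).mul_const _
    rw [mul_zero, zero_mul] at ht
    obtain ⟨R₁, h⟩ := (ht.eventually (eventually_le_nhds hη)).exists_forall_of_atTop
    exact ⟨R₁, h⟩
  -- bound on every ball `B_n`
  have hball : ∀ n : ℕ, ∫⁻ x in ball (0 : ℝ³) n, ENNReal.ofReal (frobeniusNormSq (fderiv ℝ U x)) ≤
      ENNReal.ofReal (η + cSW ν q * (ℓ + η) ^ 3) := by
    intro n
    obtain ⟨R, hR0, hRpos, hmR⟩ := exists_m_lt hU.continuous hq0 hL hη (max (2 * n) R₁)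
    have hm0 := m_nonneg (q := q) (U := U) hRpos.le
    have hnR : (n : ℝ) ≤ R / 2 := by linarith [(le_max_left _ _).trans hR0]
    calc ∫⁻ x in ball (0 : ℝ³) n, ENNReal.ofReal (frobeniusNormSq (fderiv ℝ U x))
        ≤ ∫⁻ x in ball (0 : ℝ³) (R / 2), ENNReal.ofReal (frobeniusNormSq (fderiv ℝ U x)) :=
          lintegral_mono_set (ball_subset_ball hnR)
      _ ≤ ENNReal.ofReal (k₁ q * R ^ (-(1 / 3 : ℝ)) * m q U R ^ 2 + cSW ν q * m q U R ^ 3) :=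
          lintegral_ball_le hν hq hUP hU hRpos
      _ ≤ ENNReal.ofReal (η + cSW ν q * (ℓ + η) ^ 3) := by
          refine ENNReal.ofReal_le_ofReal (add_le_add ?_ ?_)
          · have h1 : m q U R ^ 2 ≤ (ℓ + η) ^ 2 := pow_le_pow_left₀ hm0 hmR.le 2
            have h2 : 0 ≤ k₁ q * R ^ (-(1 / 3 : ℝ)) := mul_nonneg hk (Real.rpow_nonneg hRpos.le _)
            exact (mul_le_mul_of_nonneg_left h1 h2).trans (hR₁ R ((le_max_right _ _).trans hR0))
          · exact mul_le_mul_of_nonneg_left (pow_le_pow_left₀ hm0 hmR.le 3) hc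
  -- monotone convergence over the balls `B_n`
  have hunion : (⋃ n : ℕ, ball (0 : ℝ³) n) = univ := by
    refine eq_univ_of_forall fun x => mem_iUnion.2 ?_
    obtain ⟨n, hn⟩ := exists_nat_gt ‖x‖
    exact ⟨n, mem_ball_zero_iff.2 hn⟩
  have hdir : Directed (· ⊆ ·) fun n : ℕ => ball (0 : ℝ³) (n : ℝ) :=
    Monotone.directed_le fun a b hab => ball_subset_ball (by exact_mod_cast hab)
  rw [← setLIntegral_univ, ← hunion, setLIntegral_iUnion_of_directed _ hdir]
  exact iSup_le hball

/-- **The first conclusion: `D(U) ≤ c · (lim inf M)³`.** [folklore] -/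
theorem lintegral_le (hν : 0 < ν) (hq : 3 < q) (hUP : IsLerayProfile ν 0 U P)
    (hU : ContDiff ℝ ∞ U) (hL : liminf (annularMorrey q U) atTop < ⊤) :
    ∫⁻ x, ENNReal.ofReal (frobeniusNormSq (fderiv ℝ U x)) ≤
      ENNReal.ofReal (cSW ν q) * (liminf (annularMorrey q U) atTop) ^ (3 : ℕ) := by
  set L := liminf (annularMorrey q U) atTop with hLdef
  set ℓ := L.toReal with hℓ
  have hℓ0 : 0 ≤ ℓ := ENNReal.toReal_nonneg
  have hc := (cSW_pos (q := q) hν).le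
  have hLr : ENNReal.ofReal ℓ = L := ENNReal.ofReal_toReal hL.ne
  have htarget : ENNReal.ofReal (cSW ν q) * L ^ (3 : ℕ) = ENNReal.ofReal (cSW ν q * ℓ ^ 3) := by
    rw [← hLr, ← ENNReal.ofReal_pow hℓ0, ENNReal.ofReal_mul hc]
  rw [htarget]
  refine ENNReal.le_of_forall_pos_le_add fun ε hε _ => ?_
  -- choose `η`
  set A := 1 + cSW ν q * (3 * ℓ ^ 2 + 3 * ℓ + 1) with hA
  have hA0 : 0 < A := by rw [hA]; positivity
  set η := min 1 ((ε : ℝ) / A) with hηdef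
  have hη : 0 < η := lt_min one_pos (div_pos (by exact_mod_cast hε) hA0)
  have hη1 : η ≤ 1 := min_le_left _ _
  have hηA : η * A ≤ ε := by
    have : η ≤ (ε : ℝ) / A := min_le_right _ _
    rwa [le_div_iff₀ hA0] at this
  have hmain := lintegral_le_eta hν hq hUP hU hL hη
  refine hmain.trans ?_
  rw [← ENNReal.ofReal_coe_nnreal, ← ENNReal.ofReal_add (by positivity) (NNReal.coe_nonneg ε)]
  refine ENNReal.ofReal_le_ofReal ?_
  have hexp : (ℓ + η) ^ 3 ≤ ℓ ^ 3 + η * (3 * ℓ ^ 2 + 3 * ℓ + 1) := by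
    have e1 : (ℓ + η) ^ 3 = ℓ ^ 3 + η * (3 * ℓ ^ 2 + 3 * ℓ * η + η ^ 2) := by ring
    rw [e1]
    have h2 : 3 * ℓ * η ≤ 3 * ℓ := by nlinarith
    have h3 : η ^ 2 ≤ 1 := by nlinarith
    nlinarith
  calc η + cSW ν q * (ℓ + η) ^ 3 ≤ η + cSW ν q * (ℓ ^ 3 + η * (3 * ℓ ^ 2 + 3 * ℓ + 1)) := by
        gcongr
    _ = cSW ν q * ℓ ^ 3 + η * A := by rw [hA]; ring
    _ ≤ cSW ν q * ℓ ^ 3 + ε := by linarith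

/-! ### The "moreover" clause -/

/-- A linear map with vanishing Frobenius norm is zero. [folklore] -/
theorem eq_zero_of_frobeniusNormSq_eq_zero (T : ℝ³ →L[ℝ] ℝ³) (h : frobeniusNormSq T = 0) : T = 0 := by
  have h' : ∀ i, T (stdOrthonormalBasis ℝ ℝ³ i) = 0 := fun i => by
    have := (Finset.sum_eq_zero_iff_of_nonneg (fun j _ => sq_nonneg _)).1 h i (Finset.mem_univ i)
    exact norm_eq_zero.1 (pow_eq_zero_iff two_ne_zero |>.1 this)
  refine ContinuousLinearMap.ext fun v => ?_
  have hv := (stdOrthonormalBasis ℝ ℝ³).sum_repr v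
  rw [← hv, map_sum]
  simp [map_smul, h']

/-- The volume of the annulus is at least that of a ball of radius `R/4`. [folklore] -/
theorem volume_real_ann_ge {R : ℝ} (hR : 0 < R) : v₁ * (R / 4) ^ 3 ≤ (volume (ann R)).toReal := by
  set y : ℝ³ := (3 * R / 4) • e 0 with hy
  have hy_norm : ‖y‖ = 3 * R / 4 := by rw [hy, norm_smul, norm_e, mul_one, Real.norm_eq_abs, abs_of_pos (by positivity)]
  have hsub : ball y (R / 4) ⊆ ann R := by
    intro z hz
    rw [mem_ball, dist_eq_norm] at hz
    have h1 : ‖z‖ ≤ ‖z - y‖ + ‖y‖ := norm_le_norm_sub_add z y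
    have h2 : ‖y‖ ≤ ‖y - z‖ + ‖z‖ := norm_le_norm_sub_add y z
    rw [norm_sub_rev] at h2
    constructor
    · rw [mem_ball_zero_iff]; linarith
    · rw [mem_ball_zero_iff, not_lt]; linarith
  have hvol : volume (ball y (R / 4)) = ENNReal.ofReal ((R / 4) ^ 3) * volume (ball (0 : ℝ³) 1) := by
    rw [Measure.addHaar_ball _ _ (by positivity : (0 : ℝ) ≤ R / 4), finrank_euclideanSpace_fin]
  calc v₁ * (R / 4) ^ 3 = (volume (ball y (R / 4))).toReal := by
        rw [hvol, ENNReal.toReal_mul, ENNReal.toReal_ofReal (by positivity), v₁]; ring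
    _ ≤ (volume (ann R)).toReal := ENNReal.toReal_mono (volume_ann_lt_top R).ne (measure_mono hsub)

/-- For a nonzero constant field the annular quantity tends to `∞`. [folklore] -/
theorem liminf_eq_top_of_const (hq : 3 < q) {v : ℝ³} (hv : v ≠ 0) :
    liminf (annularMorrey q (fun _ : ℝ³ => v)) atTop = ⊤ := by
  have hq0 : 0 < q := by linarith
  have hvn : 0 < ‖v‖ := norm_pos_iff.2 hv
  have hv₁ := v₁_pos
  set κ := ‖v‖ * (v₁ / 64) ^ (1 / q) with hκ
  have hκ0 : 0 < κ := by rw [hκ]; positivity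
  -- lower bound `M(R) ≥ ofReal (κ R^{2/3})` for `R > 0`
  have hlow : ∀ R, 0 < R → ENNReal.ofReal (κ * R ^ (2 / 3 : ℝ)) ≤ annularMorrey q (fun _ : ℝ³ => v) R := by
    intro R hR
    rw [annularMorrey_eq_ofReal_m continuous_const hq0 hR]
    refine ENNReal.ofReal_le_ofReal ?_
    set V := (volume (ann R)).toReal with hVdef
    have hV0 : 0 ≤ V := ENNReal.toReal_nonneg
    have hJ : J q (fun _ : ℝ³ => v) R = V * ‖v‖ ^ q := by
      rw [J]; simp only [setIntegral_const, smul_eq_mul, measureReal_def, hVdef]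
    have hVge : v₁ * (R / 4) ^ 3 ≤ V := volume_real_ann_ge hR
    have hb0 : 0 ≤ v₁ * (R / 4) ^ 3 := by positivity
    have h1 : (v₁ * (R / 4) ^ 3) ^ (1 / q) ≤ V ^ (1 / q) := Real.rpow_le_rpow hb0 hVge (by positivity)
    have h2 : (V * ‖v‖ ^ q) ^ (1 / q) = V ^ (1 / q) * ‖v‖ := by
      rw [Real.mul_rpow hV0 (Real.rpow_nonneg hvn.le _), ← Real.rpow_mul hvn.le,
        mul_one_div_cancel hq0.ne', Real.rpow_one]
    have h3 : κ * R ^ (2 / 3 : ℝ) = R ^ (2 / 3 - 3 / q) * ((v₁ * (R / 4) ^ 3) ^ (1 / q) * ‖v‖) := by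
      rw [show v₁ * (R / 4) ^ 3 = v₁ / 64 * R ^ 3 by ring,
        Real.mul_rpow (by positivity) (by positivity), ← Real.rpow_natCast R 3, ← Real.rpow_mul hR.le, hκ]
      have e : R ^ (2 / 3 : ℝ) = R ^ (2 / 3 - 3 / q) * R ^ (((3 : ℕ) : ℝ) * (1 / q)) := by
        rw [← Real.rpow_add hR]; congr 1; push_cast; field_simp; ring
      rw [e]; ring
    rw [m, hJ, h2, h3]
    exact mul_le_mul_of_nonneg_left (mul_le_mul_of_nonneg_right h1 hvn.le) (Real.rpow_nonneg hR.le _)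
  have ht : Tendsto (fun R : ℝ => ENNReal.ofReal (κ * R ^ (2 / 3 : ℝ))) atTop (𝓝 ⊤) :=
    ENNReal.tendsto_ofReal_atTop.comp ((tendsto_rpow_atTop (by norm_num)).const_mul_atTop hκ0)
  have hev : ∀ᶠ R in atTop, ENNReal.ofReal (κ * R ^ (2 / 3 : ℝ)) ≤ annularMorrey q (fun _ : ℝ³ => v) R :=
    (eventually_gt_atTop 0).mono hlow
  refine top_unique ?_
  rw [← ht.liminf_eq]
  exact liminf_le_liminf hev

/-- **The "moreover" clause**: if in addition `(lim inf M)³ ≤ δ D(U)` with `0 < δ < 1/c`, then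
`U ≡ 0` (`D ≤ c·lim inf M³ ≤ cδ D` and `D < ∞` force `D = 0`, so `U` is constant, and a
nonzero constant has `lim inf M = ∞`). [cite: SereginWang2020, Thm 1.1 (i), "Moreover"] -/
theorem eq_zero_of_small (hν : 0 < ν) (hq : 3 < q) (hUP : IsLerayProfile ν 0 U P)
    (hU : ContDiff ℝ ∞ U) (hL : liminf (annularMorrey q U) atTop < ⊤) {δ : ℝ}
    (hδc : δ * cSW ν q < 1)
    (hsmall : (liminf (annularMorrey q U) atTop) ^ (3 : ℕ) ≤
      ENNReal.ofReal δ * ∫⁻ x, ENNReal.ofReal (frobeniusNormSq (fderiv ℝ U x))) :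
    U = 0 := by
  set L := liminf (annularMorrey q U) atTop with hLdef
  set D := ∫⁻ x, ENNReal.ofReal (frobeniusNormSq (fderiv ℝ U x)) with hDdef
  have hc := cSW_pos (q := q) hν
  have hD : D ≤ ENNReal.ofReal (cSW ν q) * L ^ (3 : ℕ) := lintegral_le hν hq hUP hU hL
  have hDfin : D < ⊤ := hD.trans_lt (ENNReal.mul_lt_top ENNReal.ofReal_lt_top (ENNReal.pow_lt_top hL))
  -- `D = 0`
  have hD0 : D = 0 := by
    by_contra h0
    have h1 : D ≤ ENNReal.ofReal (cSW ν q * δ) * D := by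
      calc D ≤ ENNReal.ofReal (cSW ν q) * L ^ (3 : ℕ) := hD
        _ ≤ ENNReal.ofReal (cSW ν q) * (ENNReal.ofReal δ * D) := mul_le_mul' le_rfl hsmall
        _ = ENNReal.ofReal (cSW ν q * δ) * D := by rw [ENNReal.ofReal_mul hc.le, mul_assoc]
    have h2 : ENNReal.ofReal (cSW ν q * δ) < 1 := by
      rw [← ENNReal.ofReal_one]; exact (ENNReal.ofReal_lt_ofReal_iff one_pos).2 (by rwa [mul_comm])
    have h3 : ENNReal.ofReal (cSW ν q * δ) * D < 1 * D := ENNReal.mul_lt_mul_left h0 hDfin.ne h2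
    rw [one_mul] at h3
    exact absurd (h1.trans_lt h3) (lt_irrefl _)
  -- `|∇U|² = 0` everywhere, so `U` is constant
  have hcont : Continuous fun x => ENNReal.ofReal (frobeniusNormSq (fderiv ℝ U x)) :=
    ENNReal.continuous_ofReal.comp (continuous_frobeniusNormSq_fderiv hU)
  have hae : (fun x => ENNReal.ofReal (frobeniusNormSq (fderiv ℝ U x))) =ᵐ[volume] 0 :=
    (lintegral_eq_zero_iff hcont.measurable).1 hD0
  have hzero : (fun x => ENNReal.ofReal (frobeniusNormSq (fderiv ℝ U x))) = 0 :=
    (hcont.ae_eq_iff_eq volume continuous_const).1 hae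
  have hDU : ∀ x, fderiv ℝ U x = 0 := fun x => by
    have h1 : ENNReal.ofReal (frobeniusNormSq (fderiv ℝ U x)) = 0 := congrFun hzero x
    rw [ENNReal.ofReal_eq_zero] at h1
    exact eq_zero_of_frobeniusNormSq_eq_zero _ (le_antisymm h1 (frobeniusNormSq_nonneg _))
  have hconst : ∀ x, U x = U 0 := fun x =>
    is_const_of_fderiv_eq_zero (hU.differentiable (by simp)) hDU x 0
  -- `L = 0`, whence `U 0 = 0`
  have hL0 : L = 0 := by
    have : L ^ (3 : ℕ) ≤ 0 := by simpa [hD0] using hsmall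
    exact pow_eq_zero_iff (n := 3) (by norm_num) |>.1 (le_antisymm this bot_le)
  have hU0 : U 0 = 0 := by
    by_contra hv
    have hUeq : U = fun _ => U 0 := funext hconst
    have := liminf_eq_top_of_const hq hv
    rw [← hUeq, ← hLdef, hL0] at this
    exact ENNReal.zero_ne_top this
  funext x
  rw [hconst x, hU0]; rfl

end Main

end SereginWangProof

/-- **Seregin–Wang 2020, Theorem 1.1 (i) holds** (Lebesgue instance `ℓ = q`, every `q > 3`,
every viscosity `ν > 0`), with the constant `c(q, ν) = SereginWangProof.cSW ν q`: the discharge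
of the named fact `SereginWang2020_annular_liouville`. The proof follows the printed one
(Caccioppoli inequality by testing with `φu − w`, Young/Hölder, iteration, `lim inf`), with two
deviations forced by the libraries: cubes instead of balls in the iteration, and the tree's
ring corrector (`SteadyNSRingCorrector`: truncated Newtonian potential + explicit lossy solver,
both proved, the former via the tree's Calderón–Zygmund theory) instead of Bogovskiĭ's
operator. [cite: SereginWang2020, Thm 1.1 (i)] -/
theorem SereginWang2020_annular_liouville_holds : SereginWang2020_annular_liouville := by
  intro ν hν q hq
  refine ⟨SereginWangProof.cSW ν q, SereginWangProof.cSW_pos hν, fun U P hUP hU _hP hL => ⟨?_, ?_⟩⟩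
  · exact SereginWangProof.lintegral_le hν hq hUP hU hL
  · exact fun δ _hδ hδc hsmall => SereginWangProof.eq_zero_of_small hν hq hUP hU hL hδc hsmall

end Literature.Analysis.FluidPDE

end
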